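import Mathlib.Algebra.MvPolynomial.Basic
import Mathlib.Algebra.BigOperators.Fin
import HarnessLib

/-!
# Crux `GrenetZeon.HessianRankCodimTwo` (stmt-ValiantsHypothesis-8061), line `good_plane` v2,
# stub `stub_goodPlaneThreePrime` — Theorem P, PART A: generating-function vocabulary

Theorem P of `Cruxes/HessianRankCodimTwo/GoodPlanesLatinReduction.md` §6 (val-width-8061-p2): for
every prime `p ≥ 11` the Latin block plane `{circ(a_0,a_1,a_2) ⊗ J_p}` of `3p × 3p` matrices misses
the half-rank locus of the Hessian of `per_{3p}`.  Its arithmetic core is a pair of congruences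
modulo `p` for the permanent of the Latin block point and for its `(3p-2) × (3p-2)` block
sub-permanents, both read as COEFFICIENTS OF PRODUCTS OF ROW FORMS: with
`ℓ_I(y) = Σ_J x_{J-I} y_J` (row `I` of the generic circulant `circ(x_0,x_1,x_2)` paired with
`y = (y_0,y_1,y_2)`),

* `per(circ(a) ⊗ J_p) = (p!)³ · Φ̃_p(a)`, `Φ̃_p := [y_0^p y_1^p y_2^p] ℓ_0^p ℓ_1^p ℓ_2^p`
  (`latinPhi`), and
* the block value with two rows of block `I` and two columns of block `J` removed is
  `(p-2)!·p!·p! · Ψ̃_{IJ}(a)`, `Ψ̃_{IJ} := [y^{(p,p,p) - 2e_J}] ℓ_I^{p-2} ℓ_{I+1}^p ℓ_{I+2}^p`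
  (`latinPsi`);

the factorial "fibre counts" are PART B (not in this file), and PART A proves, over any
commutative ring of characteristic `p`, `Φ̃_p = F^p` with `F = x_0³+x_1³+x_2³+3x_0x_1x_2` (`cubicF`)
and `Ψ̃_{IJ} = x_d^{p-2} P_d^p`, `d = J - I`, `P_d = x_d² + x_{d+1}x_{d+2}` (`quadP`)
(`Theorems/GrenetZeonHessianRankCodimTwoLatinFrobenius.lean`).

This file only fixes the five definitions, generically over a commutative ring `R` (used with
`R = ℤ` for the reduction modulo `p` of `…ReduceModP.lean`, and with `R` a field of characteristic
`p` for the congruences).  The outer ("`y`") polynomial ring is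
`MvPolynomial (Fin 3) (MvPolynomial (Fin 3) R)`, the inner ("`x`") ring `MvPolynomial (Fin 3) R`.
Nothing is proved here.  VP ≠ VNP is not moved: the crux only feeds the constant-factor bound
`TwoDimCoefficients`.
-/

noncomputable section

open MvPolynomial

-- single-conjunct layout `Summits/ValiantsHypothesis/ValiantsHypothesis`: duplicated namespace by design
set_option linter.dupNamespace false

namespace Summit.ValiantsHypothesis.ValiantsHypothesis.Theorems.GrenetZeonHessianRankCodimTwo

variable (R : Type*) [CommRing R]

/-- The `I`-th ROW FORM of the generic `3 × 3` circulant: `ℓ_I(y) = Σ_J x_{J-I} · y_J`, a linear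
form in the outer variables `y_J = X J` with coefficients `x_{J-I} = X (J - I)` in the inner ring
`R[x_0,x_1,x_2]` (entry `(I, J)` of `circ(x_0,x_1,x_2)` is `x_{J-I}`, the pattern of `latinBasis`:
row block `I`, column block `J` carries the coordinate `a_{J-I}`). [folklore] -/
def rowForm (I : Fin 3) : MvPolynomial (Fin 3) (MvPolynomial (Fin 3) R) :=
  ∑ J : Fin 3, C (X (J - I)) * X J

/-- The cubic `F = x_0³ + x_1³ + x_2³ + 3·x_0x_1x_2`, the permanent of `circ(x_0,x_1,x_2)`.
[folklore] -/
def cubicF : MvPolynomial (Fin 3) R :=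
  X 0 ^ 3 + X 1 ^ 3 + X 2 ^ 3 + 3 * (X 0 * X 1 * X 2)

/-- The quadrics `P_d = x_d² + x_{d+1}·x_{d+2}`, `d ∈ ℤ/3` (`P_0 = x_0²+x_1x_2`,
`P_1 = x_1²+x_2x_0`, `P_2 = x_2²+x_0x_1`). [folklore] -/
def quadP (d : Fin 3) : MvPolynomial (Fin 3) R :=
  X d ^ 2 + X (d + 1) * X (d + 2)

/-- `Φ̃_p := [y_0^p y_1^p y_2^p] ℓ_0^p ℓ_1^p ℓ_2^p ∈ R[x_0,x_1,x_2]`: the generating-function form of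
`per(circ(x) ⊗ J_p) / (p!)³` (sum over the colourings of the `3p` rows by column blocks with every
colour used `p` times, of `Π_r x_{colour(r) - block(r)}`).  Meaningful for every `p : ℕ`.
[folklore] -/
def latinPhi (p : ℕ) : MvPolynomial (Fin 3) R :=
  coeff (∑ K : Fin 3, Finsupp.single K p) (∏ I : Fin 3, rowForm R I ^ p)

/-- `Ψ̃_{IJ} := [y^{(p,p,p) - 2e_J}] ℓ_I^{p-2} ℓ_{I+1}^p ℓ_{I+2}^p ∈ R[x_0,x_1,x_2]`: the
generating-function form of the `(I,J)` block value of the Latin block point (the sub-permanent with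
two rows of row block `I` and two columns of column block `J` removed) divided by `(p-2)!·p!·p!`.
The exponent vector is written `Σ_K (if K = J then p-2 else p)·e_K`; intended for `p ≥ 2`.
[folklore] -/
def latinPsi (p : ℕ) (I J : Fin 3) : MvPolynomial (Fin 3) R :=
  coeff (∑ K : Fin 3, Finsupp.single K (if K = J then p - 2 else p))
    (rowForm R I ^ (p - 2) * (rowForm R (I + 1) ^ p * rowForm R (I + 2) ^ p))

end Summit.ValiantsHypothesis.ValiantsHypothesis.Theorems.GrenetZeonHessianRankCodimTwo
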